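import Mathlib
import Summits.Ventures.FusionMHD.Models.SAlphaSecondStableS25A525Core0
import HarnessLib

/-!
# STABLE-POINT core at `((5 / 2), 21/4)`, piece 12 (`[17, 20]`): kernel-decided Taylor-model leaves ⇒ `F_12 > 0` and `amplitudeResidual (5 / 2) (21/4) F_12 F_12″ ≤ 0` on the piece ⇒ `EnergyDominatesOn` for its amplitude phase

LADDER-GRIDFUSION rung F3 («F3.BALLOON-sα-SECOND-STABILITY-S5o2-A525»: the first certified point on the SECOND-STABILITY side of the s–α model at shear 5/2 (DIRECTOR RULING 67 (5) class; second-edge bracket at s = 5/2)); gridfusion-model-7 g10, 2026-08-28 (g8/g9 core lane).  Two `decide +kernel` calls (`OpModel.trig.pLeavesCheck`, scale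
`2^60`, Taylor degree 10, 24 leaves of half-width 1/16) and the lane's soundness theorem `OpSem.trig.pos_of_pLeavesCheck`
(Literature/Analysis/ValidatedNumerics/TaylorModelZeroCert); lit-4's `energyDominatesOn_of_amplitude` (BallooningSAlphaStableSide) turns the two
sign facts into energy domination by `amplitudePhase (5 / 2) (21/4) F_12 F_12′` on the piece.  MODELLED: `s–α` model; nothing about a device.
No `native_decide`.  Citations: Freidberg 2014 §12.6.2 (12.97) [Freidberg2014]; Makino–Berz 2003 Alg. 2 [MakinoBerz2003]; Hartman 2002 XI.6.2
[Hartman2002].  Everything here is [instance data].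
-/

open Literature.Analysis.ValidatedNumerics Literature.Analysis.ValidatedNumerics.PolyMP
open Literature.Analysis.ValidatedNumerics.NumericsMP Literature.Analysis.ValidatedNumerics.ExpPoly
open Literature.MathematicalPhysics.MHD.Ballooning
open Real Set

namespace Summit.Ventures.FusionMHD.Models

namespace SAlphaSecondStableS25A525

/-- KERNEL CHECK (residual leaves of piece 12). [instance data] -/
theorem ss25525_res12_ok : OpModel.trig.pLeavesCheck ss25525Prm (2 ^ 60) (ss25525Prog H12 (Poly.deriv (Poly.deriv H12))) [] ss25525Leaves12 = true := by
  decide +kernel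

/-- KERNEL CHECK (positivity leaves of piece 12). [instance data] -/
theorem ss25525_pos12_ok : OpModel.trig.pLeavesCheck ss25525Prm (2 ^ 60) (ss25525PosProg H12) [] ss25525Leaves12 = true := by
  decide +kernel

/-- The leaves tile `[17, 20]`. [instance data] -/
theorem ss25525_tiles12 : tiles (17 : ℚ) (ss25525Leaves12.map fun l => (l.e, l.k)) (20 : ℚ) = true := by
  decide +kernel

/-- **PIECE 12**: the phase of `F_12` dominates the `s–α` energy on `[17, 20]` at `(s, α) = ((5 / 2), 21/4)`. [instance data] -/
theorem ss25525_dominates12 :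
    SAlpha.EnergyDominatesOn (5 / 2) (21 / 4) (SAlpha.amplitudePhase (5 / 2) (21 / 4) (Poly.eval H12) (Poly.eval (Poly.deriv H12)))
      (Icc (17 : ℝ) (20 : ℝ)) := by
  have h := ss25525_dominates (lf := H12) (x := 17) (y := 20) (by norm_num) ss25525_tiles12 ss25525_res12_ok ss25525_pos12_ok
  norm_num at h
  exact h

end SAlphaSecondStableS25A525

end Summit.Ventures.FusionMHD.Models
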